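/-
Copyright (c) 2026 the pub-hodgecm-mathlib formalisation cell (harness21).  Prover seat hodgecm-mathlib-LH4-p09 (g5): Track A «(D-RAM) FOUR-FRAME» squad of crux H413, unit U2H (ii-H),
leaf (ρ2b′-X) — payer LH4-p14 (g4) socket (C) brick (C2) «H-SIDE CLOSED FORM», file (C2-iii): THE LEVEL LETTER (heir LEAD T19-05 (1)), 2026-09-04.
-/
import Literature.NumberTheory.Automorphic.UnitaryTwoDescentDiscriminantRamified   -- ★ (A-p12): `trace_eq_smul_of_descent`, `det_eq_smul_of_descent`, `disc_eq_smul_of_descent` (any fields); brings ★ `valued_toPlace_eq_sq_of_ramified` (`|ι y|_w = |y|_v²`), the Valued∕ValuativeRel bridge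
import HarnessLib

/-!
# F0 · P3c · line LH4 «(D-RAM) FOUR-FRAME» — unit (ii-H), leaf (ρ2b′-X), brick (C2-iii): THE LEVEL LETTER — the census depth `n` of the descent's torus form, the
# `w`-discriminant depth of `γ₂`, and the conductor level `j_λ` of its eigenvalue in the line model are ONE number: `|ϖ_w|^{2(2n + d_K)}·|tr γ₂|² = |4·(tr²γ₂ − 4 det γ₂)|_w`,
# hence in the tube `2n + d_K = j_λ` (class U: `d_K = 0`, `2n = j_λ`; class RK: `2n + d = j_λ`) (Labesse–Langlands 1979 §2; Rogawski 1990 §4.9; Serre, *Local Fields* XIV §4)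

Cell `pub/hodgecm-mathlib` (D-0151), crux H413 = `stmt-HodgeConjecture-24833` (helper lane `--supports stmt-HodgeConjecture-24833 --as helper`, count-neutral); THEOREMS ONLY (no
definition, no instance, no notation, no named fact, no `sorry`, default heartbeats).  Tree socket served: (ρ2b′-X) `stub_U2H_fixedPointCensus_typeTwo_unit0` (U2H ED. 15 :418)
through the payer lineage's organ interface ★ p857374 `hOrgNV` — H-side clause `#Fix_{γ₂}(U₂ ⧸ K₂) + d % 2 = N_V` with the SAME `N_V` as the G-side, whose level is lettered by
`j_λ` (S7 ★ p857461∕p857467∕p857558: `2·n_H = jl`; heir LEAD T19-05 (1): class U `2n = j_λ`, class RK `2n = j_λ − d`, class RM via T5c's `d_{K′}`).  Brick (C2) «H-SIDE CLOSED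
FORM» of this seat: ★ p857582 (C2-i) `F0P3cDyRamHSideFixedCountTorusForm` (`(q − 1)·(#Fix + d % 2) + 2 = (q + 1)·qⁿ ∕ 2·q^{n+1}` in torus-form tokens), (C2-ii)
`Literature/…/SLTwoTreeDeepEllipticTorusDatum` (the tokens + the F-LEVEL IDENTITY `|ϖ_v|^{2n + d_K}·|tr g|_v² = |4(tr²g − 4 det g)|_v`); THIS file (C2-iii) carries that identity
UP the descent to `L_w` and into the line model `M`, where it meets `j_λ` — the requests of LH4-p10 (g3) SOCKET-READER LINE #9 (2) and REF5 R5-173 (2) («print the `jlam = jl`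
line over p12's `hjl` shape `Valued.v (lam − ρ lam) = Valued.v ϖE ^ jl * Valued.v (α − ρ α)`»).

WHAT IS PROVED.
* §1 (any fields `jE : E →+* M`, `ρ : M →+* M`) `add_map_eq_and_sub_map_sq_eq`: from the eigen-package relations of ★ p857432 (`λ² = jE t·λ − jE D`, `ρλ = jE t − λ`):
  **`λ + ρλ = jE t`** and **`(λ − ρλ)² = jE (t² − 4D)`**; and the ISOMETRY TRANSFER `valued_map_eq_of_valued_eq`: a ring map with `|jE a| ≤ 1 ↔ |a| ≤ 1` (the package's `hjv`) carries
  EQUALITIES of valuations (`|x| = |y| ⇒ |jE x| = |jE y|`, unit trick).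
* §2 (the descent at a ramified CM place `w ∣ v`, ABSTRACT matrices `U ∈ M₂(L_w)`, `G ∈ M₂(L⁺_v)` with `diag(1, α)·U·diag(1, α)⁻¹ = s·ι_w(G)`, `α ≠ 0`; uniformisers `|ϖ|_w =
  exp(−1)`, `|ϖ_v|_v = exp(−1)`): **UP** `valued_pow_mul_trace_sq_eq_of_descent` — the F-identity `|ϖ_v|^k·|tr G|² = |4(tr²G − 4det G)|` becomes
  **`|ϖ|_w^{2k}·|tr U|_w² = |4(tr²U − 4 det U)|_w`** (`|ι y|_w = |y|_v²`, ★; `tr U = s·ι tr G`, `disc U = s²·ι disc G`, ★ — the scalar `s` cancels); **DOWN**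
  `valuation_disc_lt_of_descent` — the TUBE hypothesis upstairs `|tr²U − 4det U|_w < |4|_w·|ϖ|_w²·|tr U|_w²` gives (C2-ii)'s deepness `|tr²G − 4det G|_v < |4ϖ_v|_v·|tr G|_v²`
  in the `ValuativeRel` currency; and the trace token `valued_trace_eq_of_sub_two_lt` (`|tr U − 2| < |2| ⇒ |tr U| = |2|`), whence `valued_disc_eq_pow_of_deep`:
  **`|tr²U − 4det U|_w = |ϖ|_w^{2k}·|4|_w`** — the `w`-discriminant depth of `γ₂` is `2k = 2(2n + d_K)` plus `v_w(4)`.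
* §3 (the line model `M`, `jE : L_w →+* M` with `hjv`, `ρ`, `λ` with the two package relations at `t = tr U`, `D = det U`; `ϖE := jE ϖ`): the MASTER IDENTITY
  `valued_pow_mul_add_sq_eq_of_level` **`|ϖE|^{2k}·|λ + ρλ|² = |2|²·|λ − ρλ|²`** (no tube, no class); in the tube (`|λ + ρλ| = |2|`, e.g. from `|λ − 1| < |2|`:
  `valued_add_map_eq_of_sub_one_lt`) and over p12's conductor-level hypothesis `hjl : |λ − ρλ| = |ϖE|^{jl}·|α′ − ρα′|`: `valued_pow_eq_of_level` **`|ϖE|^{2k} = |ϖE|^{2jl}·|α′ − ρα′|²`**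
  (the RM reading, `|α′ − ρα′|` = T5c's generator token), and with the frame normalisation `|α′ − ρα′| = 1` (classes U, RK; ★ T5a `hα`): **`eq_of_level : k = jl`** — i.e. with
  (C2-ii)'s `k = 2n + d_K`: class U (`d_K = 0`) `2n = jl`, class RK `2n + d_K = jl` (`d_K = d`, O'Meara 63:3) — heir LEAD T19-05 (1)'s letters, LH4-p10 (g3) LINE #9 (2)'s `2 * n = jl`.
HONEST LABEL: HC_CM is proved only modulo the 7 printed citations (2 remaining named inputs: hLiu418 = stmt-HodgeConjecture-24832, h413 = stmt-HodgeConjecture-24833) until rung 0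
closes; (ρ2b′-X) stays OPEN; count-neutral valuation bookkeeping over ★ descent lemmas — nothing printed is asserted.

## References
* [LabesseLanglands1979] J.-P. Labesse, R. P. Langlands, *L-indistinguishability for SL(2)*, Canad. J. Math. 31 (1979), §2 pp. 7–8 (conductor of the torus order vs. eigenvalue depth).
* [Rogawski1990] J. D. Rogawski, *Automorphic Representations of Unitary Groups in Three Variables*, Ann. of Math. Stud. 123 (1990), §4.9 Prop. 4.9.1 (b) p. 55, Lemma 4.9.3 p. 56
  (the `H`-side terms by eigenvalue depth).
* [Serre1979] J.-P. Serre, *Local Fields*, GTM 67 (1979), Ch. XIV §4 (descent), Ch. II §2 (`e(w|v) = 2`: `|ι y|_w = |y|_v²`).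
* [Omeara1963] O. T. O'Meara, *Introduction to Quadratic Forms* (1963), §63A 63:3 (`𝔡(a·u_F) = 𝔡(a)`: class RK has `d_K = d_E`).
-/

set_option autoImplicit false

noncomputable section

namespace Summit.HodgeConjecture.HodgeConjecture.Cruxes.H413.F0P3cDyRamHSideLevelLetter

open Matrix WithZero ValuativeRel NumberField IsDedekindDomain
open Literature.NumberTheory.Automorphic Literature.NumberTheory.Automorphic.UnitaryGroup
open scoped WithZero ValuativeRel Matrix MatrixGroups

/-! ## §1 Eigen-package algebra and the isometry transfer (any fields) -/

section Generic

variable {E M : Type*} [Field E] [Field M]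

/-- From the eigen-package relations `λ² = jE t·λ − jE D`, `ρλ = jE t − λ` (★ p857432): **`λ + ρλ = jE t`** and **`(λ − ρλ)² = jE (t² − 4D)`**.
[cite: Rogawski1990, §4.9 Lemma 4.9.3 p. 56] -/
theorem add_map_eq_and_sub_map_sq_eq (jE : E →+* M) (ρ : M →+* M) {t D : E} {lam : M} (hlam2 : lam * lam = jE t * lam - jE D) (hρlam : ρ lam = jE t - lam) :
    lam + ρ lam = jE t ∧ (lam - ρ lam) ^ 2 = jE (t ^ 2 - 4 * D) := by
  refine ⟨by rw [hρlam]; ring, ?_⟩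
  rw [hρlam, map_sub, map_mul, map_pow, map_ofNat]
  linear_combination (4 : M) * hlam2

variable [Valued E ℤᵐ⁰] [Valued M ℤᵐ⁰]

/-- **ISOMETRY TRANSFER**: a ring map with `|jE a| ≤ 1 ↔ |a| ≤ 1` (the package's `hjv`) carries equalities of valuations: `|x| = |y| ⇒ |jE x| = |jE y|` (the quotient is a unit).
[cite: Serre1979, Ch. II §2] -/
theorem valued_map_eq_of_valued_eq (jE : E →+* M) (hjv : ∀ a, Valued.v (jE a) ≤ 1 ↔ Valued.v a ≤ 1) {x y : E} (h : Valued.v x = Valued.v y) :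
    Valued.v (jE x) = Valued.v (jE y) := by
  rcases eq_or_ne y 0 with hy | hy
  · subst hy
    rw [map_zero, Valuation.zero_iff] at h
    rw [h]
  · have hvy : Valued.v y ≠ 0 := (Valuation.ne_zero_iff _).2 hy
    have hvjy : Valued.v (jE y) ≠ 0 := (Valuation.ne_zero_iff _).2 ((map_ne_zero jE).2 hy)
    have hx0 : x ≠ 0 := fun hx => by rw [hx, map_zero] at h; exact hvy h.symm
    have hu : Valued.v (x / y) = 1 := by rw [map_div₀, h, div_self hvy]
    have hu' : Valued.v (y / x) = 1 := by rw [map_div₀, h, div_self hvy]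
    have h1 : Valued.v (jE (x / y)) ≤ 1 := (hjv _).2 hu.le
    have h2 : Valued.v (jE (y / x)) ≤ 1 := (hjv _).2 hu'.le
    have hxy : jE (x / y) * jE (y / x) = 1 := by rw [← map_mul, div_mul_div_comm, mul_comm x y, div_self (mul_ne_zero hy hx0), map_one]
    have hone : Valued.v (jE (x / y)) = 1 := by
      refine le_antisymm h1 ?_
      by_contra hlt
      rw [not_le] at hlt
      have := Valuation.map_mul Valued.v (jE (x / y)) (jE (y / x))
      rw [hxy, map_one] at this
      exact absurd this (ne_of_gt (mul_lt_one_of_lt_of_le hlt h2))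
    calc Valued.v (jE x) = Valued.v (jE (x / y * y)) := by rw [div_mul_cancel₀ x hy]
      _ = Valued.v (jE y) := by rw [map_mul, map_mul, hone, one_mul]

/-- A ring map with `hjv` sends a uniformiser (anything of value `< 1`, `≠ 0`) to an element of value in `(0, 1)`. [cite: Serre1979, Ch. II §2] -/
theorem valued_map_pos_and_lt_one (jE : E →+* M) (hjv : ∀ a, Valued.v (jE a) ≤ 1 ↔ Valued.v a ≤ 1) {ϖ : E} (hϖ0 : ϖ ≠ 0) (hϖ1 : Valued.v ϖ < 1) :
    0 < Valued.v (jE ϖ) ∧ Valued.v (jE ϖ) < 1 := by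
  refine ⟨(Valuation.pos_iff _).2 ((map_ne_zero jE).2 hϖ0), ?_⟩
  by_contra hge
  rw [not_lt] at hge
  have hle : Valued.v (jE ϖ⁻¹) ≤ 1 := by
    rw [map_inv₀, map_inv₀]; exact inv_le_one_of_one_le₀ hge
  have h1 := (hjv _).1 hle
  rw [map_inv₀, inv_le_one₀ ((Valuation.pos_iff _).2 hϖ0)] at h1
  exact absurd hϖ1 (not_lt.2 h1)

end Generic

/-! ## §2 The descent at a ramified CM place: the level identity UP, the tube DOWN -/

section Place

variable (L : Type) [Field L] [NumberField L] [IsCMField L] (v : HeightOneSpectrum (𝓞 ↥(maximalRealSubfield L)))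
  (w : PlacesOver L v) (hw : IsCMField.complexConj L • w.1 = w.1)

include hw in
/-- **THE LEVEL IDENTITY CARRIED UP THE DESCENT.**  At a ramified place, for `diag(1, α)·U·diag(1, α)⁻¹ = s·ι_w(G)` (`α ≠ 0`) and uniformisers `|ϖ|_w = exp(−1)`, `|ϖ_v|_v = exp(−1)`:
the identity `|ϖ_v|_v^k·|tr G|_v² = |4(tr²G − 4det G)|_v` ((C2-ii)'s conclusion with `k = 2n + d_K`) gives **`|ϖ|_w^{2k}·|tr U|_w² = |4(tr²U − 4det U)|_w`** — `|ι y|_w = |y|_v²` (★),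
`tr U = s·ι(tr G)`, `tr²U − 4det U = s²·ι(tr²G − 4det G)` (★); the scalar `s` cancels. [cite: Serre1979, Ch. XIV §4; Ch. II §2] [cite: LabesseLanglands1979, §2 p. 8] -/
theorem valued_pow_mul_trace_sq_eq_of_descent (he : v.asIdeal.ramificationIdx' w.1.asIdeal ≠ 1) {α s : w.1.adicCompletion L} (hα0 : α ≠ 0)
    {U : Matrix (Fin 2) (Fin 2) (w.1.adicCompletion L)} {G : Matrix (Fin 2) (Fin 2) (v.adicCompletion ↥(maximalRealSubfield L))}
    (hsg : Matrix.diagonal ![1, α] * U * Matrix.diagonal ![1, α⁻¹] = s • G.map (toPlace v w))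
    {ϖ : w.1.adicCompletion L} (hϖ : Valued.v ϖ = exp (-1 : ℤ)) {ϖF : v.adicCompletion ↥(maximalRealSubfield L)} (hϖF : Valued.v ϖF = exp (-1 : ℤ)) {k : ℕ}
    (hlev : Valued.v ϖF ^ k * Valued.v G.trace ^ 2 = Valued.v (4 * (G.trace ^ 2 - 4 * G.det))) :
    Valued.v ϖ ^ (2 * k) * Valued.v U.trace ^ 2 = Valued.v (4 * (U.trace ^ 2 - 4 * U.det)) := by
  have hsq := valued_toPlace_eq_sq_of_ramified L v w hw he
  -- square the F-identity and read it through `ι`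
  have hlev2 : Valued.v (toPlace v w ϖF) ^ k * Valued.v (toPlace v w G.trace) ^ 2 = Valued.v (toPlace v w (4 * (G.trace ^ 2 - 4 * G.det))) := by
    rw [hsq, hsq, hsq, ← hlev, mul_pow, pow_right_comm (Valued.v ϖF) 2 k]
  have hιϖ : Valued.v (toPlace v w ϖF) = Valued.v ϖ ^ 2 := by rw [hsq, hϖF, hϖ]
  rw [disc_eq_smul_of_descent (toPlace v w) hα0 hsg, trace_eq_smul_of_descent (toPlace v w) hα0 hsg]
  rw [show (4 : w.1.adicCompletion L) * (s ^ 2 * toPlace v w (G.trace ^ 2 - 4 * G.det)) = s ^ 2 * toPlace v w (4 * (G.trace ^ 2 - 4 * G.det)) by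
    rw [map_mul, map_ofNat]; ring]
  rw [Valuation.map_mul, Valuation.map_mul, Valuation.map_pow, ← hlev2, hιϖ, ← pow_mul, mul_pow]
  simp only [mul_comm, mul_left_comm]

include hw in
/-- **THE TUBE CARRIED DOWN THE DESCENT.**  If `|tr²U − 4det U|_w < |4|_w·|ϖ|_w²·|tr U|_w²` (the tube hypothesis on `γ₂` at `w`) then the descended `G` is DEEP in (C2-ii)'s sense:
`|tr²G − 4det G|_v < |4ϖ_v|_v·|tr G|_v²`, stated in the `ValuativeRel` currency of ★ `exists_torusDatum_of_deep`. [cite: Serre1979, Ch. XIV §4; Ch. II §2] -/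
theorem valuation_disc_lt_of_descent (he : v.asIdeal.ramificationIdx' w.1.asIdeal ≠ 1) {α s : w.1.adicCompletion L} (hα0 : α ≠ 0)
    {U : Matrix (Fin 2) (Fin 2) (w.1.adicCompletion L)} {G : Matrix (Fin 2) (Fin 2) (v.adicCompletion ↥(maximalRealSubfield L))}
    (hsg : Matrix.diagonal ![1, α] * U * Matrix.diagonal ![1, α⁻¹] = s • G.map (toPlace v w))
    {ϖ : w.1.adicCompletion L} (hϖ : Valued.v ϖ = exp (-1 : ℤ)) {ϖF : v.adicCompletion ↥(maximalRealSubfield L)} (hϖF : Valued.v ϖF = exp (-1 : ℤ))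
    (hdeepU : Valued.v (U.trace ^ 2 - 4 * U.det) < Valued.v (4 : w.1.adicCompletion L) * Valued.v ϖ ^ 2 * Valued.v U.trace ^ 2) :
    valuation (v.adicCompletion ↥(maximalRealSubfield L)) (G.trace ^ 2 - 4 * G.det) <
      valuation (v.adicCompletion ↥(maximalRealSubfield L)) (4 * ϖF) * valuation (v.adicCompletion ↥(maximalRealSubfield L)) G.trace ^ 2 := by
  have hsq := valued_toPlace_eq_sq_of_ramified L v w hw he
  have hιϖ : Valued.v (toPlace v w ϖF) = Valued.v ϖ ^ 2 := by rw [hsq, hϖF, hϖ]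
  rw [disc_eq_smul_of_descent (toPlace v w) hα0 hsg, trace_eq_smul_of_descent (toPlace v w) hα0 hsg, Valuation.map_mul, Valuation.map_mul,
    Valuation.map_pow] at hdeepU
  -- cancel `|s|²`
  have hR : Valued.v (4 : w.1.adicCompletion L) * Valued.v ϖ ^ 2 * (Valued.v s * Valued.v (toPlace v w G.trace)) ^ 2 =
      Valued.v s ^ 2 * (Valued.v (4 : w.1.adicCompletion L) * Valued.v ϖ ^ 2 * Valued.v (toPlace v w G.trace) ^ 2) := by
    rw [mul_pow]; simp only [mul_assoc, mul_left_comm]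
  rw [hR] at hdeepU
  have h1 : Valued.v (toPlace v w (G.trace ^ 2 - 4 * G.det)) < Valued.v (4 : w.1.adicCompletion L) * Valued.v ϖ ^ 2 * Valued.v (toPlace v w G.trace) ^ 2 :=
    lt_of_mul_lt_mul_left' hdeepU
  -- read everything through `ι`: `|4|_w = |ι 4|`, `|ϖ|_w² = |ι ϖ_v|`
  have h2 : Valued.v (toPlace v w (G.trace ^ 2 - 4 * G.det)) < Valued.v (toPlace v w (4 * ϖF * G.trace ^ 2)) := by
    have e : Valued.v (toPlace v w (4 * ϖF * G.trace ^ 2)) = Valued.v (4 : w.1.adicCompletion L) * Valued.v ϖ ^ 2 * Valued.v (toPlace v w G.trace) ^ 2 := by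
      rw [(toPlace v w).map_mul, (toPlace v w).map_mul, (toPlace v w).map_pow, map_ofNat, Valuation.map_mul, Valuation.map_mul, Valuation.map_pow, hιϖ]
    rw [e]; exact h1
  rw [hsq, hsq] at h2
  have h3 : Valued.v (G.trace ^ 2 - 4 * G.det) < Valued.v (4 * ϖF * G.trace ^ 2) := lt_of_pow_lt_pow_left' 2 h2
  have h4 := (v_lt_iff_valuation_lt _ _).1 h3
  rwa [map_mul, map_pow] at h4

/-- **THE TRACE TOKEN**: `|tr U − 2| < |2| ⇒ |tr U| = |2|` (in the tube, the trace of `γ₂` has the value of `2`). [cite: Rogawski1990, §4.9 p. 55] -/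
theorem valued_trace_eq_of_sub_two_lt {K : Type*} [Field K] [Valued K ℤᵐ⁰] {t : K} (ht : Valued.v (t - 2) < Valued.v (2 : K)) : Valued.v t = Valued.v (2 : K) := by
  have : t = 2 + (t - 2) := by ring
  rw [this, Valuation.map_add_eq_of_lt_left _ ht]

/-- **THE `w`-DISCRIMINANT DEPTH**: with the level identity `|ϖ|^{2k}·|tr U|² = |4·(tr²U − 4det U)|` and the trace token `|tr U| = |2|`: `|tr²U − 4det U|_w = |ϖ|_w^{2k}` — the
`w`-discriminant depth of `γ₂` is `2k = 2(2n + d_K)` (`2 ≠ 0`). [cite: LabesseLanglands1979, §2 p. 8] [cite: Rogawski1990, §4.9 Prop. 4.9.1 (b) p. 55] -/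
theorem valued_disc_eq_pow_of_deep {K : Type*} [Field K] [Valued K ℤᵐ⁰] (h2 : (2 : K) ≠ 0) {U : Matrix (Fin 2) (Fin 2) K} {ϖ : K} {k : ℕ}
    (hlevU : Valued.v ϖ ^ (2 * k) * Valued.v U.trace ^ 2 = Valued.v (4 * (U.trace ^ 2 - 4 * U.det))) (htrU : Valued.v U.trace = Valued.v (2 : K)) :
    Valued.v (U.trace ^ 2 - 4 * U.det) = Valued.v ϖ ^ (2 * k) := by
  have h4 : Valued.v (4 : K) = Valued.v (2 : K) ^ 2 := by rw [← map_pow]; norm_num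
  have h40 : Valued.v (2 : K) ^ 2 ≠ 0 := pow_ne_zero 2 ((Valuation.ne_zero_iff _).2 h2)
  rw [htrU, map_mul, h4, mul_comm (Valued.v (2 : K) ^ 2)] at hlevU
  exact (mul_right_cancel₀ h40 hlevU).symm

end Place

/-! ## §3 The line model: the master identity and the class letters -/

section Model

variable {E M : Type*} [Field E] [Field M] [Valued E ℤᵐ⁰] [Valued M ℤᵐ⁰]

/-- **THE MASTER LEVEL IDENTITY IN THE LINE MODEL** (no tube, no class).  `jE : E →+* M` with `hjv`, `ρ : M →+* M`, `λ` with the package relations at `(t, D) = (tr U, det U)`, and the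
level identity upstairs `|ϖ|^{2k}·|tr U|² = |4(tr²U − 4det U)|`: then with `ϖE := jE ϖ`, **`|ϖE|^{2k}·|λ + ρλ|² = |2|²·|λ − ρλ|²`**.
[cite: LabesseLanglands1979, §2 p. 8] [cite: Rogawski1990, §4.9 Lemma 4.9.3 p. 56] -/
theorem valued_pow_mul_add_sq_eq_of_level (jE : E →+* M) (hjv : ∀ a, Valued.v (jE a) ≤ 1 ↔ Valued.v a ≤ 1) (ρ : M →+* M)
    {U : Matrix (Fin 2) (Fin 2) E} {lam : M} (hlam2 : lam * lam = jE U.trace * lam - jE U.det) (hρlam : ρ lam = jE U.trace - lam)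
    {ϖ : E} {k : ℕ} (hlevU : Valued.v ϖ ^ (2 * k) * Valued.v U.trace ^ 2 = Valued.v (4 * (U.trace ^ 2 - 4 * U.det))) :
    Valued.v (jE ϖ) ^ (2 * k) * Valued.v (lam + ρ lam) ^ 2 = Valued.v (2 : M) ^ 2 * Valued.v (lam - ρ lam) ^ 2 := by
  obtain ⟨hadd, hsub⟩ := add_map_eq_and_sub_map_sq_eq jE ρ hlam2 hρlam
  have h := valued_map_eq_of_valued_eq jE hjv (x := ϖ ^ (2 * k) * U.trace ^ 2) (y := 4 * (U.trace ^ 2 - 4 * U.det))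
    (by rw [map_mul, map_pow, map_pow, hlevU])
  have hx : jE (ϖ ^ (2 * k) * U.trace ^ 2) = (jE ϖ) ^ (2 * k) * (lam + ρ lam) ^ 2 := by rw [map_mul, map_pow, map_pow, hadd]
  have hy : jE (4 * (U.trace ^ 2 - 4 * U.det)) = 4 * (lam - ρ lam) ^ 2 := by rw [map_mul, map_ofNat, ← hsub]
  rw [hx, hy, map_mul, map_pow, map_pow, map_mul, map_pow] at h
  rw [h]
  congr 1
  rw [← map_pow]; norm_num

/-- **THE TRACE TOKEN IN THE MODEL**: `|λ − 1| < |2|` (with `ρ` isometric) gives `|λ + ρλ| = |2|`. [cite: Rogawski1990, §4.9 p. 55] -/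
theorem valued_add_map_eq_of_sub_one_lt (ρ : M →+* M) (hvρ : ∀ z, Valued.v (ρ z) = Valued.v z) {lam : M} (h : Valued.v (lam - 1) < Valued.v (2 : M)) :
    Valued.v (lam + ρ lam) = Valued.v (2 : M) := by
  have hρ : Valued.v (ρ (lam - 1)) < Valued.v (2 : M) := by rw [hvρ]; exact h
  have hsum : Valued.v ((lam - 1) + ρ (lam - 1)) < Valued.v (2 : M) := lt_of_le_of_lt (Valuation.map_add _ _ _) (max_lt h hρ)
  have : lam + ρ lam = 2 + ((lam - 1) + ρ (lam - 1)) := by rw [map_sub, map_one]; ring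
  rw [this, Valuation.map_add_eq_of_lt_left _ hsum]

/-- **THE LEVEL LETTER, GENERAL (RM reading)**: master identity + trace token `|λ + ρλ| = |2|` (`2 ≠ 0`) + the conductor-level hypothesis `hjl : |λ − ρλ| = |ϖE|^{jl}·|α′ − ρα′|`
(LH4-p12 (g4)'s shape) ⇒ **`|ϖE|^{2k} = |ϖE|^{2jl}·|α′ − ρα′|²`**. [cite: LabesseLanglands1979, §2 p. 8] [cite: Rogawski1990, §4.9 Prop. 4.9.1 (b) p. 55] -/
theorem valued_pow_eq_of_level (h2 : (2 : M) ≠ 0) {ϖE lam ρlam αg ραg : M} {k jl : ℕ}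
    (hmaster : Valued.v ϖE ^ (2 * k) * Valued.v (lam + ρlam) ^ 2 = Valued.v (2 : M) ^ 2 * Valued.v (lam - ρlam) ^ 2)
    (htr : Valued.v (lam + ρlam) = Valued.v (2 : M)) (hjl : Valued.v (lam - ρlam) = Valued.v ϖE ^ jl * Valued.v (αg - ραg)) :
    Valued.v ϖE ^ (2 * k) = Valued.v ϖE ^ (2 * jl) * Valued.v (αg - ραg) ^ 2 := by
  have h40 : Valued.v (2 : M) ^ 2 ≠ 0 := pow_ne_zero 2 ((Valuation.ne_zero_iff _).2 h2)
  rw [htr, hjl, mul_pow, ← pow_mul, mul_comm jl 2] at hmaster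
  exact mul_right_cancel₀ h40 (hmaster.trans (mul_comm _ _))

/-- **THE LEVEL LETTER, CLASSES U AND RK: `k = jl`** — with the frame normalisation `|α′ − ρα′| = 1` (★ T5a's `hα`; `M ∕ E` unramified) and `0 < |ϖE| < 1`, `|ϖE|^{2k} = |ϖE|^{2jl}` forces
`k = jl`; with (C2-ii)'s `k = 2n + d_K` this is heir LEAD T19-05 (1): class U `2n = j_λ` (`d_K = 0`), class RK `2n + d = j_λ` (`d_K = d`). [cite: LabesseLanglands1979, §2 p. 8] [cite: Rogawski1990, §4.9 Prop. 4.9.1 (b) p. 55] [cite: Omeara1963, §63A 63:3] -/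
theorem eq_of_level (h2 : (2 : M) ≠ 0) {ϖE lam ρlam αg ραg : M} (hϖE0 : 0 < Valued.v ϖE) (hϖE1 : Valued.v ϖE < 1) {k jl : ℕ}
    (hmaster : Valued.v ϖE ^ (2 * k) * Valued.v (lam + ρlam) ^ 2 = Valued.v (2 : M) ^ 2 * Valued.v (lam - ρlam) ^ 2)
    (htr : Valued.v (lam + ρlam) = Valued.v (2 : M)) (hjl : Valued.v (lam - ρlam) = Valued.v ϖE ^ jl * Valued.v (αg - ραg)) (hα : Valued.v (αg - ραg) = 1) :
    k = jl := by
  have h := valued_pow_eq_of_level h2 hmaster htr hjl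
  rw [hα, one_pow, mul_one] at h
  have hinj : Function.Injective (fun m : ℕ => Valued.v ϖE ^ m) := (pow_right_strictAnti₀ hϖE0 hϖE1).injective
  have := hinj h
  omega

/-- **THE LEVEL LETTER OF (ρ2b′-X), CLASSES U ∕ RK, ONE CALL** — for the HEAD of the census file: `jE : L_w →+* M` with `hjv`, `ρ` isometric, `λ` with the package relations at `(tr U, det U)`,
`ϖ` a uniformiser of `L_w` (`0 < |ϖ| < 1`), the level identity upstairs at exponent `k` (★ §2 from (C2-ii)), the tube `|λ − 1| < |2|`, p12's `hjl` and `|α′ − ρα′| = 1`: **`k = jl`**.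
[cite: LabesseLanglands1979, §2 p. 8] [cite: Rogawski1990, §4.9 Prop. 4.9.1 (b) p. 55, Lemma 4.9.3 p. 56] -/
theorem eq_conductorLevel_of_level_of_tube (h2 : (2 : M) ≠ 0) (jE : E →+* M) (hjv : ∀ a, Valued.v (jE a) ≤ 1 ↔ Valued.v a ≤ 1) (ρ : M →+* M)
    (hvρ : ∀ z, Valued.v (ρ z) = Valued.v z) {U : Matrix (Fin 2) (Fin 2) E} {lam : M} (hlam2 : lam * lam = jE U.trace * lam - jE U.det) (hρlam : ρ lam = jE U.trace - lam)
    {ϖ : E} (hϖ0 : ϖ ≠ 0) (hϖ1 : Valued.v ϖ < 1) {k : ℕ} (hlevU : Valued.v ϖ ^ (2 * k) * Valued.v U.trace ^ 2 = Valued.v (4 * (U.trace ^ 2 - 4 * U.det)))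
    (htube : Valued.v (lam - 1) < Valued.v (2 : M)) {jl : ℕ} {αg : M} (hjl : Valued.v (lam - ρ lam) = Valued.v (jE ϖ) ^ jl * Valued.v (αg - ρ αg))
    (hα : Valued.v (αg - ρ αg) = 1) : k = jl := by
  obtain ⟨hpos, hlt⟩ := valued_map_pos_and_lt_one jE hjv hϖ0 hϖ1
  exact eq_of_level h2 hpos hlt (valued_pow_mul_add_sq_eq_of_level jE hjv ρ hlam2 hρlam hlevU) (valued_add_map_eq_of_sub_one_lt ρ hvρ htube) hjl hα

end Model

end Summit.HodgeConjecture.HodgeConjecture.Cruxes.H413.F0P3cDyRamHSideLevelLetter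

end
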